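import Summits.AtomisticToContinuum.HydrodynamicLimit.Theorems.EnskogAdjointDualityDualityReductionFSide
import Summits.AtomisticToContinuum.HydrodynamicLimit.Theorems.EnskogAdjointDualityDualityReductionMoments
import HarnessLib

/-!
# EnskogAdjointDuality / CollisionResidualVanishes — the Euler (local-Maxwellian) side of the
# duality identity under a velocity cutoff (cutoff toolkit T3)

Support lemmas for the crux `Summit.AtomisticToContinuum.HydrodynamicLimit.Theses.EnskogAdjointDuality.CollisionResidualVanishes`
(K1, stmt-AtomisticToContinuum-14658, line `birth`, lead c6). After the refutation of
`AdjointEnskogTestFamilyR` as typed (2026-08-17: no admissible family has defect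
`|Dφ + Lφ| ≤ η(1+|v|²)` for ALL `v`), the repaired duality glue asks the defect bound only below a
velocity cutoff `‖v‖ ≤ V` together with a crude global polynomial bound `|Dφ + Lφ| ≤ C_g(1+|v|²)³`.
On the Euler side the defect is paired with the local Maxwellian `f_s = ρ_s M_{1,θ_s,u_s}`, so the
part above the cutoff is a Gaussian tail: `1_{‖v‖>V} ≤ ‖v‖²/V²` turns the global bound into
`(C_g/V²)(1+|v|²)⁴`, and the landed Euler-side estimate `abs_I3_add_half_I2_le` goes through with
the weight `(1+|v|²)⁴` in place of `(1+|v|²)²`. This file generalises the Euler-side chain of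
`…DualityReductionFSide.lean` / `…DualityReductionMaxwellian.lean` to an arbitrary weight exponent
`m` and derives the cutoff estimate:

* `exists_integral_one_add_norm_sq_pow_gaussMeasure_le` — `∫ (1+|v|²)^m dN(u, θ) ≤ C(U, Θ, m)`;
* `integrable_localMaxwellian_mul_of_abs_le_pow`, `abs_integral_localMaxwellian_mul_le_pow`,
  `integrable_f_mul_of_abs_le_pow`, `integrable_x_f_mul_of_abs_le_pow`,
  `integrableOn_s_f_mul_of_abs_le_pow` — the `v`-, `x`-, `s`-level integrability with weight
  `(1+|v|²)^m`;
* `abs_I3_add_half_I2_le_pow` — `|I₃ + ½I₂| ≤ η t R C_G` under `|D + L| ≤ η(1+|v|²)^m`;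
* `abs_I3_add_half_I2_le_cut` — the velocity-cutoff version:
  `|I₃ + ½I₂| ≤ (η + C_g/V²) t R C_G⁽⁴⁾`.

References: H. Spohn, *Large Scale Dynamics of Interacting Particles* (1991), Part I §3.3;
M. Pulvirenti, S. Simonella, arXiv:1504.03215, §2 [PulvirentiSimonella2016].
-/

noncomputable section

open MeasureTheory ProbabilityTheory Set Filter Topology Function
open scoped ENNReal BigOperators InnerProductSpace

namespace Summit.AtomisticToContinuum.HydrodynamicLimit.Theorems

open Literature.Analysis.FluidPDE Literature.MathematicalPhysics.KineticTheory

/-! ## Gaussian weights of every order -/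

/-- Uniform bound `∫ (1 + |v|²)^m dN(u, θ id) ≤ C(U, Θ, m)` for `‖u‖ ≤ U`, `0 < θ ≤ Θ`. [folklore] -/
theorem exists_integral_one_add_norm_sq_pow_gaussMeasure_le (U Θ : ℝ) (m : ℕ) :
    ∃ C : ℝ, 0 ≤ C ∧ ∀ (u : V3) (θ : ℝ), ‖u‖ ≤ U → 0 < θ → θ ≤ Θ →
      ∫ v, (1 + ‖v‖ ^ 2) ^ m ∂gaussMeasure u θ ≤ C := by
  rcases Nat.eq_zero_or_pos m with hm | hm
  · subst hm
    refine ⟨1, zero_le_one, fun u θ _ _ _ => ?_⟩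
    simp
  · obtain ⟨C₂, hC₂0, hC₂⟩ :=
      exists_integral_norm_pow_gaussMeasure_le U Θ (n := 2 * m) (by omega)
    refine ⟨2 ^ (m - 1) * (1 + C₂), by positivity, fun u θ hu hθ hθΘ => ?_⟩
    have h2m : Integrable (fun v : V3 => ‖v‖ ^ (2 * m)) (gaussMeasure u θ) :=
      (IsGaussian.memLp_id _ (2 * m : ℕ) (ENNReal.natCast_ne_top _)).integrable_norm_pow
        (by exact_mod_cast (by omega : 2 * m ≠ 0))
    have hpt : ∀ v : V3, (1 + ‖v‖ ^ 2) ^ m ≤ 2 ^ (m - 1) * (1 + ‖v‖ ^ (2 * m)) := fun v => by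
      simpa only [one_pow, ← pow_mul] using add_pow_le zero_le_one (sq_nonneg ‖v‖) m
    calc ∫ v, (1 + ‖v‖ ^ 2) ^ m ∂gaussMeasure u θ
        ≤ ∫ v, 2 ^ (m - 1) * (1 + ‖v‖ ^ (2 * m)) ∂gaussMeasure u θ :=
          integral_mono_of_nonneg (Eventually.of_forall fun v => by positivity)
            (((integrable_const _).add h2m).const_mul _) (Eventually.of_forall hpt)
      _ = 2 ^ (m - 1) * (1 + ∫ v, ‖v‖ ^ (2 * m) ∂gaussMeasure u θ) := by
          rw [integral_const_mul, integral_add (integrable_const _) h2m, integral_const,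
            smul_eq_mul, probReal_univ, one_mul]
      _ ≤ 2 ^ (m - 1) * (1 + C₂) := by gcongr; exact hC₂ u θ hu hθ hθΘ

/-- Pairing the local Maxwellian with a measurable kernel of growth `|g| ≤ K (1 + |v|²)^m` is
absolutely convergent. [folklore] -/
theorem integrable_localMaxwellian_mul_of_abs_le_pow {θ : ℝ} (hθ : 0 < θ) (u : V3) {g : V3 → ℝ}
    (hg : AEStronglyMeasurable g volume) {K : ℝ} {m : ℕ} (hK : ∀ v, |g v| ≤ K * (1 + ‖v‖ ^ 2) ^ m) :
    Integrable (fun v => localMaxwellian 1 θ u v * g v) := by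
  have hdom : Integrable (fun v => localMaxwellian 1 θ u v * (K * (1 + ‖v‖ ^ 2) ^ m)) := by
    rw [integrable_localMaxwellian_mul_iff hθ]
    exact (integrable_one_add_norm_sq_pow_gaussMeasure u θ m).const_mul K
  refine hdom.mono' ((continuous_localMaxwellian 1 θ u).aestronglyMeasurable.mul hg)
    (Eventually.of_forall fun v => ?_)
  rw [Real.norm_eq_abs, abs_mul, abs_of_nonneg (localMaxwellian_nonneg zero_le_one hθ.le u v)]
  exact mul_le_mul_of_nonneg_left (hK v) (localMaxwellian_nonneg zero_le_one hθ.le u v)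

/-- `|∫ M g| ≤ K ∫ (1 + |v|²)^m dN(u, θ id)` for a kernel `|g| ≤ K (1 + |v|²)^m`. [folklore] -/
theorem abs_integral_localMaxwellian_mul_le_pow {θ : ℝ} (hθ : 0 < θ) (u : V3) {g : V3 → ℝ}
    {K : ℝ} {m : ℕ} (hK : ∀ v, |g v| ≤ K * (1 + ‖v‖ ^ 2) ^ m) :
    |∫ v, localMaxwellian 1 θ u v * g v| ≤ K * ∫ v, (1 + ‖v‖ ^ 2) ^ m ∂gaussMeasure u θ := by
  rw [integral_localMaxwellian_mul_eq_integral_gaussMeasure hθ, ← integral_const_mul]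
  have h := norm_integral_le_of_norm_le
    ((integrable_one_add_norm_sq_pow_gaussMeasure u θ m).const_mul K)
    (Eventually.of_forall fun v => by rw [Real.norm_eq_abs]; exact hK v)
  rwa [Real.norm_eq_abs] at h

section FSide

variable {ρ θ : ℝ → T3 → ℝ} {u : ℝ → T3 → V3} {t R U Θ CG : ℝ}
  {f : ℝ → T3 → V3 → ℝ} {m : ℕ}

/-- `v`-level, weight `(1+|v|²)^m`: `|∫ f_s(x,·) h| ≤ R K C_G`. [folklore] -/
theorem integrable_f_mul_of_abs_le_pow
    (hρ : ∀ s ∈ Icc 0 t, ∀ x, 0 ≤ ρ s x ∧ ρ s x ≤ R) (hu : ∀ s ∈ Icc 0 t, ∀ x, ‖u s x‖ ≤ U)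
    (hθ : ∀ s ∈ Icc 0 t, ∀ x, 0 < θ s x ∧ θ s x ≤ Θ)
    (hCG : ∀ (u' : V3) (θ' : ℝ), ‖u'‖ ≤ U → 0 < θ' → θ' ≤ Θ →
      ∫ v, (1 + ‖v‖ ^ 2) ^ m ∂gaussMeasure u' θ' ≤ CG)
    (hf : ∀ s x v, f s x v = ρ s x * localMaxwellian 1 (θ s x) (u s x) v)
    {s : ℝ} (hs : s ∈ Icc 0 t) (x : T3) {h : V3 → ℝ} (hm : Measurable h) {K : ℝ}
    (hK : ∀ v, |h v| ≤ K * (1 + ‖v‖ ^ 2) ^ m) :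
    Integrable (fun v => f s x v * h v) ∧ |∫ v, f s x v * h v| ≤ R * (K * CG) := by
  have hfun : (fun v => f s x v * h v) =
      fun v => ρ s x * (localMaxwellian 1 (θ s x) (u s x) v * h v) := by
    funext v; rw [hf]; ring
  rw [hfun]
  have hθx := hθ s hs x
  have hρx := hρ s hs x
  refine ⟨(integrable_localMaxwellian_mul_of_abs_le_pow hθx.1 _ hm.aestronglyMeasurable
    hK).const_mul _, ?_⟩
  rw [integral_const_mul, abs_mul, abs_of_nonneg hρx.1]
  have hK0 : 0 ≤ K := by simpa using (abs_nonneg _).trans (hK 0)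
  refine mul_le_mul hρx.2 ((abs_integral_localMaxwellian_mul_le_pow hθx.1 _ hK).trans ?_)
    (abs_nonneg _) ((hρx.1).trans hρx.2)
  exact mul_le_mul_of_nonneg_left (hCG _ _ (hu s hs x) hθx.1 hθx.2) hK0

/-- `x`-level, weight `(1+|v|²)^m`. [folklore] -/
theorem integrable_x_f_mul_of_abs_le_pow
    (hρ : ∀ s ∈ Icc 0 t, ∀ x, 0 ≤ ρ s x ∧ ρ s x ≤ R) (hu : ∀ s ∈ Icc 0 t, ∀ x, ‖u s x‖ ≤ U)
    (hθ : ∀ s ∈ Icc 0 t, ∀ x, 0 < θ s x ∧ θ s x ≤ Θ)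
    (hCG : ∀ (u' : V3) (θ' : ℝ), ‖u'‖ ≤ U → 0 < θ' → θ' ≤ Θ →
      ∫ v, (1 + ‖v‖ ^ 2) ^ m ∂gaussMeasure u' θ' ≤ CG)
    (hf : ∀ s x v, f s x v = ρ s x * localMaxwellian 1 (θ s x) (u s x) v)
    {s : ℝ} (hs : s ∈ Icc 0 t) (hfm : Measurable fun q : T3 × V3 => f s q.1 q.2)
    {H : T3 → V3 → ℝ} (hHm : Measurable fun q : T3 × V3 => H q.1 q.2) {K : ℝ}
    (hK : ∀ x v, |H x v| ≤ K * (1 + ‖v‖ ^ 2) ^ m) :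
    Integrable (fun x => ∫ v, f s x v * H x v) ∧
      |∫ x, ∫ v, f s x v * H x v| ≤ R * (K * CG) := by
  have hsm : StronglyMeasurable fun q : T3 × V3 => f s q.1 q.2 * H q.1 q.2 :=
    (hfm.mul hHm).stronglyMeasurable
  have hint : StronglyMeasurable fun x : T3 => ∫ v, f s x v * H x v :=
    hsm.integral_prod_right'
  have hbd : ∀ x, |∫ v, f s x v * H x v| ≤ R * (K * CG) := fun x =>
    (integrable_f_mul_of_abs_le_pow hρ hu hθ hCG hf hs x
      (hHm.comp (measurable_const.prodMk measurable_id)) (fun v => hK x v)).2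
  refine ⟨?_, ?_⟩
  · exact (integrable_const (R * (K * CG))).mono' hint.aestronglyMeasurable
      (Eventually.of_forall fun x => by rw [Real.norm_eq_abs]; exact hbd x)
  · have h := norm_integral_le_of_norm_le (integrable_const (R * (K * CG)))
      (Eventually.of_forall fun x => by rw [Real.norm_eq_abs]; exact hbd x)
      (f := fun x : T3 => ∫ v, f s x v * H x v) (μ := volume)
    rw [integral_const, smul_eq_mul, probReal_univ, one_mul, Real.norm_eq_abs] at h
    exact h

/-- `s`-level, weight `(1+|v|²)^m`. [folklore] -/
theorem integrableOn_s_f_mul_of_abs_le_pow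
    (hρ : ∀ s ∈ Icc 0 t, ∀ x, 0 ≤ ρ s x ∧ ρ s x ≤ R) (hu : ∀ s ∈ Icc 0 t, ∀ x, ‖u s x‖ ≤ U)
    (hθ : ∀ s ∈ Icc 0 t, ∀ x, 0 < θ s x ∧ θ s x ≤ Θ)
    (hCG : ∀ (u' : V3) (θ' : ℝ), ‖u'‖ ≤ U → 0 < θ' → θ' ≤ Θ →
      ∫ v, (1 + ‖v‖ ^ 2) ^ m ∂gaussMeasure u' θ' ≤ CG)
    (hf : ∀ s x v, f s x v = ρ s x * localMaxwellian 1 (θ s x) (u s x) v)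
    {Φf : ℝ × T3 × V3 → ℝ} (hΦm : Measurable Φf) (hΦf : ∀ s ∈ Icc 0 t, ∀ x v, Φf (s, x, v) = f s x v)
    {H : ℝ → T3 → V3 → ℝ} (hHm : Measurable fun p : ℝ × T3 × V3 => H p.1 p.2.1 p.2.2)
    {S : Set ℝ} (hSsub : S ⊆ Icc 0 t)
    (hSae : ∀ᵐ s ∂(volume.restrict (Icc 0 t)), s ∈ S) {K : ℝ}
    (hK : ∀ s ∈ S, ∀ x v, |H s x v| ≤ K * (1 + ‖v‖ ^ 2) ^ m) :
    IntegrableOn (fun s => ∫ x, ∫ v, f s x v * H s x v) (Icc 0 t) ∧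
      ∀ s ∈ S, |∫ x, ∫ v, f s x v * H s x v| ≤ R * (K * CG) := by
  -- measurability through the frozen modification
  have hsm : StronglyMeasurable fun q : (ℝ × T3) × V3 =>
      Φf (q.1.1, q.1.2, q.2) * H q.1.1 q.1.2 q.2 := by
    have hre : Measurable fun q : (ℝ × T3) × V3 => ((q.1.1, q.1.2, q.2) : ℝ × T3 × V3) := by
      fun_prop
    exact ((hΦm.comp hre).mul (hHm.comp hre)).stronglyMeasurable
  have h1 : StronglyMeasurable fun q : ℝ × T3 => ∫ v, Φf (q.1, q.2, v) * H q.1 q.2 v :=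
    hsm.integral_prod_right'
  have h2 : StronglyMeasurable fun s : ℝ => ∫ x, ∫ v, Φf (s, x, v) * H s x v :=
    h1.integral_prod_right'
  have hbd : ∀ s ∈ S, |∫ x, ∫ v, f s x v * H s x v| ≤ R * (K * CG) := by
    intro s hsS
    have hs : s ∈ Icc 0 t := hSsub hsS
    have hfm : Measurable fun q : T3 × V3 => f s q.1 q.2 := by
      have : (fun q : T3 × V3 => f s q.1 q.2) = fun q => Φf (s, q.1, q.2) := by
        funext q; rw [hΦf s hs]
      rw [this]
      exact hΦm.comp (measurable_const.prodMk measurable_id)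
    exact (integrable_x_f_mul_of_abs_le_pow hρ hu hθ hCG hf hs hfm (H := H s)
      (hHm.comp (measurable_const.prodMk measurable_id)) (fun x v => hK s hsS x v)).2
  refine ⟨?_, hbd⟩
  have hae : (fun s => ∫ x, ∫ v, f s x v * H s x v) =ᵐ[volume.restrict (Icc 0 t)]
      fun s => ∫ x, ∫ v, Φf (s, x, v) * H s x v := by
    filter_upwards [ae_restrict_mem measurableSet_Icc] with s hs
    simp_rw [hΦf s hs]
  refine Integrable.congr ?_ hae.symm
  refine (integrable_const (R * (K * CG))).mono' h2.aestronglyMeasurable ?_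
  filter_upwards [hSae, ae_restrict_mem measurableSet_Icc] with s hsS hs
  rw [Real.norm_eq_abs]
  have : (∫ x, ∫ v, Φf (s, x, v) * H s x v) = ∫ x, ∫ v, f s x v * H s x v := by
    simp_rw [hΦf s hs]
  rw [this]
  exact hbd s hsS

/-- **The Euler side of the duality identity, weight `(1+|v|²)^m`.** As `abs_I3_add_half_I2_le` with
`|L| ≤ K(1+|v|²)^m`, `|D + L| ≤ η(1+|v|²)^m` and the Gaussian bound for `(1+|v|²)^m`:
`|∫₀ᵗ∫∫ f (D + ½L) + ½ ∫₀ᵗ∫∫ f L| ≤ η · t · R · C_G`. [cite: PulvirentiSimonella2016, §2] -/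
theorem abs_I3_add_half_I2_le_pow (ht : 0 < t)
    (hρ : ∀ s ∈ Icc 0 t, ∀ x, 0 ≤ ρ s x ∧ ρ s x ≤ R) (hu : ∀ s ∈ Icc 0 t, ∀ x, ‖u s x‖ ≤ U)
    (hθ : ∀ s ∈ Icc 0 t, ∀ x, 0 < θ s x ∧ θ s x ≤ Θ)
    (hCG : ∀ (u' : V3) (θ' : ℝ), ‖u'‖ ≤ U → 0 < θ' → θ' ≤ Θ →
      ∫ v, (1 + ‖v‖ ^ 2) ^ m ∂gaussMeasure u' θ' ≤ CG)
    (hf : ∀ s x v, f s x v = ρ s x * localMaxwellian 1 (θ s x) (u s x) v)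
    {Φf : ℝ × T3 × V3 → ℝ} (hΦm : Measurable Φf) (hΦf : ∀ s ∈ Icc 0 t, ∀ x v, Φf (s, x, v) = f s x v)
    (D L : ℝ → T3 → V3 → ℝ) {Dm Lm : ℝ × T3 × V3 → ℝ} (hDm : Measurable Dm) (hLm : Measurable Lm)
    (hDD : ∀ s ∈ Ioo 0 t, ∀ x v, D s x v = Dm (s, x, v))
    (hLL : ∀ s ∈ Icc 0 t, ∀ x v, L s x v = Lm (s, x, v))
    {K η : ℝ} (hLb : ∀ s ∈ Icc 0 t, ∀ x v, |L s x v| ≤ K * (1 + ‖v‖ ^ 2) ^ m)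
    (hDL : ∀ s ∈ Icc 0 t, ∀ x v, |D s x v + L s x v| ≤ η * (1 + ‖v‖ ^ 2) ^ m) :
    |(∫ s in Icc 0 t, ∫ x, ∫ v, f s x v * (D s x v + (1 / 2 : ℝ) * L s x v)) +
        (1 / 2 : ℝ) * ∫ s in Icc 0 t, ∫ x, ∫ v, f s x v * L s x v| ≤
      η * (t * (R * CG)) := by
  -- the three kernels on `ℝ × 𝕋³ × ℝ³`, curried
  set HL : ℝ → T3 → V3 → ℝ := fun s x v => Lm (s, x, v) with hHL
  set HDL : ℝ → T3 → V3 → ℝ := fun s x v => Dm (s, x, v) + Lm (s, x, v) with hHDL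
  set H3 : ℝ → T3 → V3 → ℝ := fun s x v => Dm (s, x, v) + (1 / 2 : ℝ) * Lm (s, x, v) with hH3
  have hHLm : Measurable fun p : ℝ × T3 × V3 => HL p.1 p.2.1 p.2.2 := hLm
  have hHDLm : Measurable fun p : ℝ × T3 × V3 => HDL p.1 p.2.1 p.2.2 := hDm.add hLm
  have hH3m : Measurable fun p : ℝ × T3 × V3 => H3 p.1 p.2.1 p.2.2 := hDm.add (hLm.const_mul _)
  -- kernel bounds on the (open) window
  have hIoo : Ioo 0 t ⊆ Icc 0 t := Ioo_subset_Icc_self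
  have hbL : ∀ s ∈ Icc 0 t, ∀ x v, |HL s x v| ≤ K * (1 + ‖v‖ ^ 2) ^ m := fun s hs x v => by
    simp only [hHL]
    rw [← hLL s hs]
    exact hLb s hs x v
  have hbDL : ∀ s ∈ Ioo 0 t, ∀ x v, |HDL s x v| ≤ η * (1 + ‖v‖ ^ 2) ^ m := fun s hs x v => by
    simp only [hHDL]
    rw [← hDD s hs, ← hLL s (hIoo hs)]
    exact hDL s (hIoo hs) x v
  have hb3 : ∀ s ∈ Ioo 0 t, ∀ x v, |H3 s x v| ≤ (η + K / 2) * (1 + ‖v‖ ^ 2) ^ m :=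
      fun s hs x v => by
    have e : H3 s x v = HDL s x v - 1 / 2 * HL s x v := by
      simp only [hH3, hHDL, hHL]; ring
    rw [e]
    calc |HDL s x v - 1 / 2 * HL s x v| ≤ |HDL s x v| + |1 / 2 * HL s x v| := abs_sub _ _
      _ ≤ η * (1 + ‖v‖ ^ 2) ^ m + 1 / 2 * (K * (1 + ‖v‖ ^ 2) ^ m) := by
          have h1 := hbDL s hs x v
          have h2 : |1 / 2 * HL s x v| ≤ 1 / 2 * (K * (1 + ‖v‖ ^ 2) ^ m) := by
            rw [abs_mul, abs_of_pos (by norm_num : (0 : ℝ) < 1 / 2)]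
            exact mul_le_mul_of_nonneg_left (hbL s (hIoo hs) x v) (by norm_num)
          linarith
      _ = (η + K / 2) * (1 + ‖v‖ ^ 2) ^ m := by ring
  -- a.e. in `[0, t]` we are in the open window
  have hnull : volume ({0, t} : Set ℝ) = 0 := ((Set.finite_singleton t).insert 0).measure_zero _
  have hIooae : ∀ᵐ s ∂(volume : Measure ℝ), s ∈ Icc 0 t → s ∈ Ioo 0 t := by
    filter_upwards [compl_mem_ae_iff.2 hnull] with s hs hsI
    simp only [mem_compl_iff, mem_insert_iff, mem_singleton_iff, not_or] at hs
    exact ⟨lt_of_le_of_ne hsI.1 (Ne.symm hs.1), lt_of_le_of_ne hsI.2 hs.2⟩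
  have hSae : ∀ᵐ s ∂(volume.restrict (Icc 0 t)), s ∈ Ioo 0 t := by
    rw [ae_restrict_iff' measurableSet_Icc]
    exact hIooae
  -- slices of `f` are measurable on the window
  have hfslice : ∀ s ∈ Icc 0 t, Measurable fun q : T3 × V3 => f s q.1 q.2 := by
    intro s hs
    have : (fun q : T3 × V3 => f s q.1 q.2) = fun q => Φf (s, q.1, q.2) := by
      funext q; rw [hΦf s hs]
    rw [this]
    exact hΦm.comp (measurable_const.prodMk measurable_id)
  -- `s`-level integrability of the three pieces
  obtain ⟨hIL, -⟩ := integrableOn_s_f_mul_of_abs_le_pow hρ hu hθ hCG hf hΦm hΦf hHLm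
    (S := Icc 0 t) Subset.rfl (ae_restrict_mem measurableSet_Icc) hbL
  obtain ⟨hI3, -⟩ :=
    integrableOn_s_f_mul_of_abs_le_pow hρ hu hθ hCG hf hΦm hΦf hH3m hIoo hSae hb3
  obtain ⟨-, hbdDL⟩ :=
    integrableOn_s_f_mul_of_abs_le_pow hρ hu hθ hCG hf hΦm hΦf hHDLm hIoo hSae hbDL
  -- the `x`/`v`-level splitting, for `s` in the open window
  have hsplit : ∀ s ∈ Ioo 0 t,
      (∫ x, ∫ v, f s x v * H3 s x v) + (1 / 2 : ℝ) * (∫ x, ∫ v, f s x v * HL s x v) =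
        ∫ x, ∫ v, f s x v * HDL s x v := by
    intro s hso
    have hs : s ∈ Icc 0 t := hIoo hso
    obtain ⟨hx3, -⟩ := integrable_x_f_mul_of_abs_le_pow hρ hu hθ hCG hf hs (hfslice s hs)
      (H := H3 s) (hH3m.comp (measurable_const.prodMk measurable_id)) (fun x v => hb3 s hso x v)
    obtain ⟨hxL, -⟩ := integrable_x_f_mul_of_abs_le_pow hρ hu hθ hCG hf hs (hfslice s hs)
      (H := HL s) (hHLm.comp (measurable_const.prodMk measurable_id)) (fun x v => hbL s hs x v)
    rw [← integral_const_mul, ← integral_add hx3 (hxL.const_mul _)]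
    refine integral_congr_ae (Eventually.of_forall fun x => ?_)
    obtain ⟨hv3, -⟩ := integrable_f_mul_of_abs_le_pow hρ hu hθ hCG hf hs x (h := H3 s x)
      (hH3m.comp (measurable_const.prodMk (measurable_const.prodMk measurable_id)))
      (fun v => hb3 s hso x v)
    obtain ⟨hvL, -⟩ := integrable_f_mul_of_abs_le_pow hρ hu hθ hCG hf hs x (h := HL s x)
      (hHLm.comp (measurable_const.prodMk (measurable_const.prodMk measurable_id)))
      (fun v => hbL s hs x v)
    show (∫ v, f s x v * H3 s x v) + (1 / 2 : ℝ) * ∫ v, f s x v * HL s x v =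
      ∫ v, f s x v * HDL s x v
    rw [← integral_const_mul, ← integral_add hv3 (hvL.const_mul _)]
    refine integral_congr_ae (Eventually.of_forall fun v => ?_)
    simp only [hH3, hHDL, hHL]
    ring
  -- identify the route's integrands with the kernels
  have hI3eq : (∫ s in Icc 0 t, ∫ x, ∫ v, f s x v * (D s x v + (1 / 2 : ℝ) * L s x v)) =
      ∫ s in Icc 0 t, ∫ x, ∫ v, f s x v * H3 s x v := by
    refine setIntegral_congr_ae measurableSet_Icc ?_
    filter_upwards [hIooae] with s hs hsI
    have hso := hs hsI
    simp only [hH3, hDD s hso, hLL s hsI]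
  have hILeq : (∫ s in Icc 0 t, ∫ x, ∫ v, f s x v * L s x v) =
      ∫ s in Icc 0 t, ∫ x, ∫ v, f s x v * HL s x v := by
    refine setIntegral_congr_fun measurableSet_Icc fun s hs => ?_
    simp only [hHL, hLL s hs]
  -- assemble
  calc |(∫ s in Icc 0 t, ∫ x, ∫ v, f s x v * (D s x v + (1 / 2 : ℝ) * L s x v)) +
        (1 / 2 : ℝ) * ∫ s in Icc 0 t, ∫ x, ∫ v, f s x v * L s x v|
      = |∫ s in Icc 0 t, ((∫ x, ∫ v, f s x v * H3 s x v) +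
          (1 / 2 : ℝ) * ∫ x, ∫ v, f s x v * HL s x v)| := by
        rw [hI3eq, hILeq, integral_add hI3 (hIL.const_mul _), integral_const_mul]
    _ = |∫ s in Icc 0 t, ∫ x, ∫ v, f s x v * HDL s x v| := by
        congr 1
        refine setIntegral_congr_ae measurableSet_Icc ?_
        filter_upwards [hIooae] with s hs hsI
        exact hsplit s (hs hsI)
    _ ≤ R * (η * CG) * (volume : Measure ℝ).real (Icc 0 t) := by
        have h := norm_setIntegral_le_of_norm_le_const_ae (μ := (volume : Measure ℝ))
          (s := Icc 0 t) (f := fun s => ∫ x, ∫ v, f s x v * HDL s x v) (C := R * (η * CG))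
          (by rw [Real.volume_Icc]; exact ENNReal.ofReal_lt_top) ?_
        · rwa [Real.norm_eq_abs] at h
        · filter_upwards [hSae] with s hso
          rw [Real.norm_eq_abs]
          exact hbdDL s hso
    _ = η * (t * (R * CG)) := by
        rw [Real.volume_real_Icc_of_le ht.le, sub_zero]
        ring

/-- **The Euler side of the duality identity under a velocity cutoff.** With the defect bound
`|D + L| ≤ η(1+|v|²)` asked only for `‖v‖ ≤ V` (`0 < V`) and a global polynomial bound
`|D + L| ≤ C_g(1+|v|²)³`, and `|L| ≤ K(1+|v|²)²` as in the route: since `1_{‖v‖>V} ≤ ‖v‖²/V²`, one has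
`|D + L| ≤ (η + C_g/V²)(1+|v|²)⁴` everywhere, hence
`|∫₀ᵗ∫∫ f (D + ½L) + ½ ∫₀ᵗ∫∫ f L| ≤ (η + C_g/V²) · t · R · C_G⁽⁴⁾` with `C_G⁽⁴⁾` the uniform Gaussian
bound of `∫(1+|v|²)⁴ dN(u, θ)` (`abs_I3_add_half_I2_le_pow`, `m = 4`). [cite: PulvirentiSimonella2016, §2] -/
theorem abs_I3_add_half_I2_le_cut (ht : 0 < t)
    (hρ : ∀ s ∈ Icc 0 t, ∀ x, 0 ≤ ρ s x ∧ ρ s x ≤ R) (hu : ∀ s ∈ Icc 0 t, ∀ x, ‖u s x‖ ≤ U)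
    (hθ : ∀ s ∈ Icc 0 t, ∀ x, 0 < θ s x ∧ θ s x ≤ Θ)
    (hCG : ∀ (u' : V3) (θ' : ℝ), ‖u'‖ ≤ U → 0 < θ' → θ' ≤ Θ →
      ∫ v, (1 + ‖v‖ ^ 2) ^ 4 ∂gaussMeasure u' θ' ≤ CG)
    (hf : ∀ s x v, f s x v = ρ s x * localMaxwellian 1 (θ s x) (u s x) v)
    {Φf : ℝ × T3 × V3 → ℝ} (hΦm : Measurable Φf) (hΦf : ∀ s ∈ Icc 0 t, ∀ x v, Φf (s, x, v) = f s x v)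
    (D L : ℝ → T3 → V3 → ℝ) {Dm Lm : ℝ × T3 × V3 → ℝ} (hDm : Measurable Dm) (hLm : Measurable Lm)
    (hDD : ∀ s ∈ Ioo 0 t, ∀ x v, D s x v = Dm (s, x, v))
    (hLL : ∀ s ∈ Icc 0 t, ∀ x v, L s x v = Lm (s, x, v))
    {K η Cg V : ℝ} (hLb : ∀ s ∈ Icc 0 t, ∀ x v, |L s x v| ≤ K * (1 + ‖v‖ ^ 2) ^ 2) (hη : 0 ≤ η)
    (hV : 0 < V)
    (hDL : ∀ s ∈ Icc 0 t, ∀ x v, ‖v‖ ≤ V → |D s x v + L s x v| ≤ η * (1 + ‖v‖ ^ 2))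
    (hDLg : ∀ s ∈ Icc 0 t, ∀ x v, |D s x v + L s x v| ≤ Cg * (1 + ‖v‖ ^ 2) ^ 3) :
    |(∫ s in Icc 0 t, ∫ x, ∫ v, f s x v * (D s x v + (1 / 2 : ℝ) * L s x v)) +
        (1 / 2 : ℝ) * ∫ s in Icc 0 t, ∫ x, ∫ v, f s x v * L s x v| ≤
      (η + Cg / V ^ 2) * (t * (R * CG)) := by
  -- the constants are nonnegative: read the bounds at time `0` and the origin of phase space
  have h0 : (0 : ℝ) ∈ Icc 0 t := ⟨le_rfl, ht.le⟩
  have hCg : 0 ≤ Cg :=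
    nonneg_of_mul_nonneg_left ((abs_nonneg _).trans (hDLg 0 h0 0 0)) (by positivity)
  have hK : 0 ≤ K :=
    nonneg_of_mul_nonneg_left ((abs_nonneg _).trans (hLb 0 h0 0 0)) (by positivity)
  have hone : ∀ v : V3, (1 : ℝ) ≤ 1 + ‖v‖ ^ 2 := fun v => le_add_of_nonneg_right (sq_nonneg _)
  have hLb' : ∀ s ∈ Icc 0 t, ∀ x v, |L s x v| ≤ K * (1 + ‖v‖ ^ 2) ^ 4 := fun s hs x v =>
    (hLb s hs x v).trans
      (mul_le_mul_of_nonneg_left (pow_le_pow_right₀ (hone v) (by norm_num)) hK)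
  -- `|D + L| ≤ (η + C_g/V²)(1+|v|²)⁴`: below the cutoff by `hDL`, above by `hDLg`, `V² < |v|²`
  have hDL' : ∀ s ∈ Icc 0 t, ∀ x v,
      |D s x v + L s x v| ≤ (η + Cg / V ^ 2) * (1 + ‖v‖ ^ 2) ^ 4 := by
    intro s hs x v
    rcases le_or_gt ‖v‖ V with hvV | hvV
    · calc |D s x v + L s x v| ≤ η * (1 + ‖v‖ ^ 2) := hDL s hs x v hvV
        _ ≤ η * (1 + ‖v‖ ^ 2) ^ 4 :=
            mul_le_mul_of_nonneg_left (le_self_pow₀ (hone v) (by norm_num)) hη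
        _ ≤ (η + Cg / V ^ 2) * (1 + ‖v‖ ^ 2) ^ 4 :=
            mul_le_mul_of_nonneg_right (le_add_of_nonneg_right (by positivity)) (by positivity)
    · have hq : 1 ≤ ‖v‖ ^ 2 / V ^ 2 := by
        rw [le_div_iff₀ (by positivity), one_mul]
        exact pow_le_pow_left₀ hV.le hvV.le 2
      calc |D s x v + L s x v| ≤ Cg * (1 + ‖v‖ ^ 2) ^ 3 := hDLg s hs x v
        _ ≤ Cg * (1 + ‖v‖ ^ 2) ^ 3 * (‖v‖ ^ 2 / V ^ 2) :=
            le_mul_of_one_le_right (by positivity) hq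
        _ = Cg / V ^ 2 * ((1 + ‖v‖ ^ 2) ^ 3 * ‖v‖ ^ 2) := by ring
        _ ≤ Cg / V ^ 2 * (1 + ‖v‖ ^ 2) ^ 4 := by
            refine mul_le_mul_of_nonneg_left ?_ (by positivity)
            rw [pow_succ]
            exact mul_le_mul_of_nonneg_left (by linarith) (by positivity)
        _ ≤ (η + Cg / V ^ 2) * (1 + ‖v‖ ^ 2) ^ 4 :=
            mul_le_mul_of_nonneg_right (le_add_of_nonneg_left hη) (by positivity)
  exact abs_I3_add_half_I2_le_pow ht hρ hu hθ hCG hf hΦm hΦf D L hDm hLm hDD hLL hLb' hDL'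

end FSide

/-- **Registered form** (sub-goal `cutoff_fside_bound` of the crux stmt-AtomisticToContinuum-14658, line `birth`): `abs_I3_add_half_I2_le_cut` as a closed `∀`-statement — the Euler side of the duality identity with the defect bound asked only below a velocity cutoff plus a global polynomial bound. [cite: PulvirentiSimonella2016, §2] -/
theorem cutoff_fside_bound : ∀ {ρ θ : ℝ → T3 → ℝ} {u : ℝ → T3 → V3} {t R U Θ CG : ℝ} {f : ℝ → T3 → V3 → ℝ} (ht : 0 < t) (hρ : ∀ s ∈ Icc 0 t, ∀ x, 0 ≤ ρ s x ∧ ρ s x ≤ R) (hu : ∀ s ∈ Icc 0 t, ∀ x, ‖u s x‖ ≤ U) (hθ : ∀ s ∈ Icc 0 t, ∀ x, 0 < θ s x ∧ θ s x ≤ Θ) (hCG : ∀ (u' : V3) (θ' : ℝ), ‖u'‖ ≤ U → 0 < θ' → θ' ≤ Θ → ∫ v, (1 + ‖v‖ ^ 2) ^ 4 ∂gaussMeasure u' θ' ≤ CG) (hf : ∀ s x v, f s x v = ρ s x * localMaxwellian 1 (θ s x) (u s x) v) {Φf : ℝ × T3 × V3 → ℝ} (hΦm : Measurable Φf) (hΦf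 : ∀ s ∈ Icc 0 t, ∀ x v, Φf (s, x, v) = f s x v) (D L : ℝ → T3 → V3 → ℝ) {Dm Lm : ℝ × T3 × V3 → ℝ} (hDm : Measurable Dm) (hLm : Measurable Lm) (hDD : ∀ s ∈ Ioo 0 t, ∀ x v, D s x v = Dm (s, x, v)) (hLL : ∀ s ∈ Icc 0 t, ∀ x v, L s x v = Lm (s, x, v)) {K η Cg V : ℝ} (hLb : ∀ s ∈ Icc 0 t, ∀ x v, |L s x v| ≤ K * (1 + ‖v‖ ^ 2) ^ 2) (hη : 0 ≤ η) (hV : 0 < V) (hDL : ∀ s ∈ Icc 0 t, ∀ x v, ‖v‖ ≤ V → |D s x v + L s x v| ≤ η * (1 + ‖v‖ ^ 2)) (hDLg : ∀ s ∈ Icc 0 t, ∀ x v, |D s x v + L s x v| ≤ Cg * (1 + ‖v‖ ^ 2) ^ 3), |(∫ s in Icc 0 t, ∫ x, ∫ v, f s x v * (D s x v + (1 / 2 : ℝ) * L s x v)) + (1 / 2 : ℝ) * ∫ s in Icc 0 t, ∫ x, ∫ v, f s x v * L s x v| ≤ (η + Cg / V ^ 2) * (t * (R * CG)) :=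
  @abs_I3_add_half_I2_le_cut

end Summit.AtomisticToContinuum.HydrodynamicLimit.Theorems

end
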